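import Summits.CriticalPhenomena.PercolationContinuityZ3.Theorems.PercNearOneGluingNoHeavyPcintWindowCert
import HarnessLib

/-!
# PCINT lane: the window automaton with a general weight, and the generic window-certificate assembly

Cell `prim-pcint`, seat `prim-pcint-2`; memo `run/shared/lean/prim/pcint/REDUCTIONS.md` §R2.
Does NOT build on p205010.

* `windowAutW` — the window automaton of `…PcintWindowAut` with an arbitrary nonnegative transition weight;
  `run_windowAutW_eq`, `stepSum_windowAutW`.
* `sum_le_geometric_of_windowCertW` — GENERIC assembly: if a per-word weight `F ≤ 1` on the "good" words is
  dominated on long words by `B · run` of the window automaton, a Collatz–Wielandt vector gives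
  `Σ_{good words of length n} F ≤ C λⁿ`.
-/

noncomputable section

namespace Summit.CriticalPhenomena.PercolationContinuityZ3.Theorems.Pcint

open Finset Literature.Probability.Percolation Literature.Probability.LatticeModels

variable {d m : ℕ}

/-! ### The window automaton with a general weight -/

/-- The window automaton with acceptance test `ok` and arbitrary nonnegative transition weight `wt`. [folklore] -/
def windowAutW (ok : (Fin m → Fin d × Bool) → Fin d × Bool → Bool) (wt : (Fin m → Fin d × Bool) → Fin d × Bool → ℝ)
    (hwt : ∀ u a, 0 ≤ wt u a) : WAut (Fin m → Fin d × Bool) (Fin d × Bool) where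
  step u a := if ok u a then some (wshift u a) else none
  wt := wt
  wt_nonneg := hwt

/-- The row sum of `windowAutW` in explicit form. [folklore] -/
theorem stepSum_windowAutW (ok : (Fin m → Fin d × Bool) → Fin d × Bool → Bool)
    (wt : (Fin m → Fin d × Bool) → Fin d × Bool → ℝ) (hwt : ∀ u a, 0 ≤ wt u a)
    (v : (Fin m → Fin d × Bool) → ℝ) (u : Fin m → Fin d × Bool) :
    (windowAutW ok wt hwt).stepSum v u = ∑ a : Fin d × Bool, if ok u a then wt u a * v (wshift u a) else 0 := by
  unfold WAut.stepSum windowAutW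
  refine Finset.sum_congr rfl fun a _ => ?_
  by_cases h : ok u a <;> simp [h]

variable (a₀ : Fin d × Bool)

/-- **The run along a word** for `windowAutW`: the product of the window weights when every window is accepted.
[folklore] -/
theorem run_windowAutW_eq (ok : (Fin m → Fin d × Bool) → Fin d × Bool → Bool)
    (wt : (Fin m → Fin d × Bool) → Fin d × Bool → ℝ) (hwt : ∀ u a, 0 ≤ wt u a) :
    ∀ (k : ℕ) (w : Fin (m + k) → Fin d × Bool),
      (∀ t < k, ok (winAt a₀ w t) (wordAt a₀ w (t + m)) = true) →
      (windowAutW ok wt hwt).run k (winAt a₀ w 0) (fun j => w ⟨m + j.1, by omega⟩) =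
        ∏ t ∈ Finset.range k, wt (winAt a₀ w t) (wordAt a₀ w (t + m))
  | 0, w, _ => by simp [WAut.run]
  | k + 1, w, hok => by
    rw [WAut.run_succ]
    have h0 : (fun j : Fin (k + 1) => w ⟨m + j.1, by omega⟩) 0 = wordAt a₀ w (0 + m) := by
      rw [zero_add, wordAt_of_lt a₀ w (by omega : m < m + (k + 1))]; rfl
    have hstep : (windowAutW ok wt hwt).step (winAt a₀ w 0) ((fun j : Fin (k + 1) => w ⟨m + j.1, by omega⟩) 0)
        = some (winAt a₀ w 1) := by
      rw [h0]
      show (if ok (winAt a₀ w 0) (wordAt a₀ w (0 + m)) then some (wshift (winAt a₀ w 0) (wordAt a₀ w (0 + m)))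
        else none) = some (winAt a₀ w 1)
      rw [hok 0 (by omega), if_pos rfl, wshift_winAt]
    rw [hstep]
    simp only
    have htail : Fin.tail (fun j : Fin (k + 1) => w ⟨m + j.1, by omega⟩)
        = fun j : Fin k => (wdrop (N := m + k) w) ⟨m + j.1, by omega⟩ := by
      funext j
      show w _ = w _
      exact congrArg w (Fin.ext (by simp only [Fin.val_succ]; omega))
    have ih := run_windowAutW_eq ok wt hwt k (wdrop (N := m + k) w) (fun t ht => by
      rw [winAt_wdrop, wordAt_wdrop, show t + m + 1 = (t + 1) + m by ring]; exact hok (t + 1) (by omega))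
    rw [htail, ← winAt_wdrop a₀ w 0, ih, Finset.prod_range_succ' _ k]
    simp only [winAt_wdrop, wordAt_wdrop, h0]
    rw [mul_comm]
    congr 1
    refine Finset.prod_congr rfl fun t _ => ?_
    rw [show t + m + 1 = t + 1 + m by ring]

/-! ### Generic assembly: domination on long words + Collatz–Wielandt ⇒ geometric bound -/

/-- **Generic window certificate.** Let `F` be a weight on words with `0 ≤ F ≤ 1` on the good words, dominated
on words of length `m + k` by `B · run_k` of a window automaton (`0 ≤ B ≤ 1`) admitting a Collatz–Wielandt
vector with `λ < 1`.  Then `Σ_{good words of length n} F ≤ C λⁿ` for all `n`. [folklore] -/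
theorem sum_le_geometric_of_windowCertW (ok : (Fin m → Fin d × Bool) → Fin d × Bool → Bool)
    (wt : (Fin m → Fin d × Bool) → Fin d × Bool → ℝ) (hwt : ∀ u a, 0 ≤ wt u a)
    (Good : ∀ n, Finset (Fin n → Fin d × Bool)) (F : ∀ n, (Fin n → Fin d × Bool) → ℝ)
    (hF1 : ∀ n w, w ∈ Good n → F n w ≤ 1)
    {B : ℝ} (hB0 : 0 ≤ B) (hB1 : B ≤ 1)
    (hdom : ∀ (k : ℕ) (w : Fin (m + k) → Fin d × Bool), w ∈ Good (m + k) →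
      F (m + k) w ≤ B * (windowAutW ok wt hwt).run k (winAt a₀ w 0) (fun j => w ⟨m + j.1, by omega⟩))
    (v : (Fin m → Fin d × Bool) → ℝ) {vmin vmax lam : ℝ} (hvmin : 0 < vmin)
    (hv : ∀ u, vmin ≤ v u) (hvmax : ∀ u, v u ≤ vmax) (hlam0 : 0 < lam)
    (hcw : ∀ u, (windowAutW ok wt hwt).stepSum v u ≤ lam * v u) :
    ∃ C, ∀ n, ∑ w ∈ Good n, F n w ≤ C * lam ^ n := by
  classical
  set M := windowAutW ok wt hwt with hM
  have hvmax0 : 0 ≤ vmax := hvmin.le.trans ((hv (fun _ => a₀)).trans (hvmax _))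
  set C : ℝ := (∑ n ∈ Finset.range m, (2 * d : ℝ) ^ n / lam ^ n) + (2 * d : ℝ) ^ m * vmax / (vmin * lam ^ m)
    with hC
  refine ⟨C, fun n => ?_⟩
  by_cases hn : n < m
  · have hcount : ∑ w ∈ Good n, F n w ≤ (2 * d : ℝ) ^ n := by
      calc ∑ w ∈ Good n, F n w ≤ ∑ _w ∈ Good n, (1 : ℝ) := Finset.sum_le_sum fun w hw => hF1 n w hw
        _ = (Good n).card := by simp
        _ ≤ ((Finset.univ : Finset (Fin n → Fin d × Bool)).card : ℝ) := by
            exact_mod_cast Finset.card_le_univ _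
        _ = (2 * d : ℝ) ^ n := by
            rw [Finset.card_univ, Fintype.card_fun, Fintype.card_prod, Fintype.card_fin, Fintype.card_fin,
              Fintype.card_bool]; push_cast; ring
    have hterm : (2 * d : ℝ) ^ n ≤ C * lam ^ n := by
      have h1 : (2 * d : ℝ) ^ n = ((2 * d : ℝ) ^ n / lam ^ n) * lam ^ n := by
        rw [div_mul_cancel₀]; exact (pow_pos hlam0 n).ne'
      rw [h1]
      refine mul_le_mul_of_nonneg_right ?_ (pow_nonneg hlam0.le _)
      rw [hC]
      have hle : (2 * d : ℝ) ^ n / lam ^ n ≤ ∑ i ∈ Finset.range m, (2 * d : ℝ) ^ i / lam ^ i :=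
        Finset.single_le_sum (f := fun i => (2 * d : ℝ) ^ i / lam ^ i) (fun i _ => by positivity)
          (Finset.mem_range.2 hn)
      have : 0 ≤ (2 * d : ℝ) ^ m * vmax / (vmin * lam ^ m) :=
        div_nonneg (mul_nonneg (by positivity) hvmax0) (by positivity)
      linarith
    exact hcount.trans hterm
  · obtain ⟨k, rfl⟩ : ∃ k, n = m + k := ⟨n - m, by omega⟩
    have hall : ∑ w ∈ Good (m + k), F (m + k) w ≤
        ∑ w : Fin (m + k) → Fin d × Bool, B * M.run k (winAt a₀ w 0) (fun j => w ⟨m + j.1, by omega⟩) :=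
      (Finset.sum_le_sum (hdom k)).trans (Finset.sum_le_univ_sum_of_nonneg fun w =>
        mul_nonneg hB0 (M.run_nonneg _ _ _))
    have hsplit : ∑ w : Fin (m + k) → Fin d × Bool, B * M.run k (winAt a₀ w 0) (fun j => w ⟨m + j.1, by omega⟩)
        = B * ∑ u : Fin m → Fin d × Bool, M.total k u := by
      rw [← (Fin.appendEquiv m k).sum_comp, Fintype.sum_prod_type, Finset.mul_sum]
      refine Finset.sum_congr rfl fun u _ => ?_
      rw [WAut.total, Finset.mul_sum]
      refine Finset.sum_congr rfl fun r _ => ?_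
      simp only [Fin.appendEquiv, Equiv.coe_fn_mk]
      rw [winAt_append_zero, tail_append]
    have htot : ∑ u : Fin m → Fin d × Bool, M.total k u ≤ (2 * d : ℝ) ^ m * (lam ^ k * vmax / vmin) := by
      calc ∑ u : Fin m → Fin d × Bool, M.total k u ≤ ∑ _u : Fin m → Fin d × Bool, lam ^ k * vmax / vmin := by
            refine Finset.sum_le_sum fun u _ => (M.total_le_of_cw hvmin hv hlam0.le hcw k u).trans ?_
            exact div_le_div_of_nonneg_right (mul_le_mul_of_nonneg_left (hvmax u) (pow_nonneg hlam0.le _)) hvmin.le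
        _ = (2 * d : ℝ) ^ m * (lam ^ k * vmax / vmin) := by
            rw [Finset.sum_const, Finset.card_univ, Fintype.card_fun, Fintype.card_prod, Fintype.card_fin,
              Fintype.card_fin, Fintype.card_bool, nsmul_eq_mul]; push_cast; ring
    calc ∑ w ∈ Good (m + k), F (m + k) w
        ≤ B * ∑ u : Fin m → Fin d × Bool, M.total k u := hall.trans hsplit.le
      _ ≤ 1 * ((2 * d : ℝ) ^ m * (lam ^ k * vmax / vmin)) :=
          mul_le_mul hB1 htot (Finset.sum_nonneg fun u _ =>
            Finset.sum_nonneg fun w _ => M.run_nonneg _ _ _) zero_le_one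
      _ = ((2 * d : ℝ) ^ m * vmax / (vmin * lam ^ m)) * lam ^ (m + k) := by
          field_simp; ring
      _ ≤ C * lam ^ (m + k) := by
          refine mul_le_mul_of_nonneg_right ?_ (pow_nonneg hlam0.le _)
          rw [hC]
          have : 0 ≤ ∑ i ∈ Finset.range m, (2 * d : ℝ) ^ i / lam ^ i :=
            Finset.sum_nonneg fun i _ => by positivity
          linarith

end Summit.CriticalPhenomena.PercolationContinuityZ3.Theorems.Pcint
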